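import Summits.ResolutionOfSingularities.KangarooAtlas.MizutaniTheoremF
import HarnessLib

/-!
# Mizutani's conjecture `m(e) = 2p^e − 1` — the ideals `J^q` and `I_S` of a tower in coordinates; THEOREM F intrinsically

Cell topic `Summits/ResolutionOfSingularities/KangarooAtlas` (pub-rosobs); namespace
`Summit.ResolutionOfSingularities.KangarooAtlas.Mizutani`.  Part of the Lean transcription of the
in-house note MIZUTANI-PROOF-g59 (AI-written, AI-audited; *AI review is weaker than expert review*; not a
resolution theorem).  §3 DICTIONARY, step (G): for a tower `K = L(x^{1/q})` (`IsRootTower`, encloser-1's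
`MizutaniRootTower*`) the hypotheses of THEOREM F (`theoremF_rootTower`: "the coordinates `Ω ω` involve only
monomials of degree `≥ q` and some GENUINE monomial") are derived from the INTRINSIC conditions of the note's
§1.2, `ω ∈ J^q` and `ω ∉ I_S = (J^{[p]})^{q/p}` (`J = ker` of multiplication, `J^{[p]}` its Frobenius power):

* `degIdeal m` — the ideal of `K[u]/(u^q)` of classes whose box representative has all monomials of degree
  `≥ m`; `Ω̃(J^q) ⊆ degIdeal q` (`omegaTilde_mem_degIdeal`), i.e. **`ω ∈ J^q ⇒` degrees `≥ q`**;
* `omegaTilde_bijective` (given `[K : L] = q^s`) and `mk X_i^p ∈ Ω̃(J^{[p]})`, whence **`ω ∉ I_S ⇒ Ω ω` has a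
  genuine monomial** (`exists_isGenuine_of_not_mem`);
* **`theoremF_of_mem_pow`** — THEOREM F, intrinsic form: `ω ∈ J^q ∖ I_S ⇒ 2q ≤ rank_L ω` (with `s ≥ 2` and
  `e ≥ 1` derived from the existence of a genuine monomial).

References: [Mizutani1973HironakaGroupSchemes] Remark 2.10 (in-house proof §1.2, §2); [Oda1983HironakaGroupSchemeII]
§1 (p. 1166: "{(δa)^λ ; |λ| ≥ r} form a basis of Δ^{(r)}").
-/

open MvPolynomial TensorProduct Literature.AlgebraicGeometry.Resolution

namespace Summit.ResolutionOfSingularities.KangarooAtlas.Mizutani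

/-! ## Degree ideals of the truncated polynomial ring -/

section DegIdeal

variable {K : Type*} [Field K] {s q : ℕ}

/-- Monomials of a truncated product have degree at least the degrees of the factors' monomials allow:
if every monomial of `f` has degree `≥ a` and every monomial of `g` has degree `≥ b`, every monomial of
`trunc (f g)` has degree `≥ a + b`. [folklore] -/
theorem degree_le_of_mem_support_trunc_mul {a b : ℕ} {f g : MvPolynomial (Fin s) K}
    (hf : ∀ M ∈ f.support, a ≤ M.degree) (hg : ∀ M ∈ g.support, b ≤ M.degree)
    {M : Fin s →₀ ℕ} (hM : M ∈ (trunc q (f * g)).support) : a + b ≤ M.degree := by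
  classical
  have hM' : M ∈ (f * g).support := by
    rw [mem_support_iff] at hM ⊢
    rw [coeff_trunc] at hM
    split_ifs at hM with h
    · exact hM
    · exact absurd rfl hM
  obtain ⟨M₁, hM₁, M₂, hM₂, rfl⟩ := Finset.mem_add.mp (support_mul f g hM')
  rw [map_add]
  exact Nat.add_le_add (hf M₁ hM₁) (hg M₂ hM₂)

variable (K s q)

/-- **The degree ideal** `degIdeal m ⊂ K[u]/(u^q)`: classes whose box representative only involves monomials
of degree `≥ m` (the image of `J^m`, MIZUTANI-PROOF-g59 §1.2 `J^n = ⊕_{|M| ≥ n} k t^M`).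
[cite: Mizutani1973HironakaGroupSchemes, Remark 2.10 (in-house proof §1.2)] -/
noncomputable def degIdeal (m : ℕ) : Ideal (BoxQuot (Fin s) K q) where
  carrier := {z | ∀ M ∈ (truncQ (Fin s) K q z).support, m ≤ M.degree}
  zero_mem' := by
    intro M hM
    rw [map_zero, support_zero] at hM
    exact absurd hM (Finset.notMem_empty M)
  add_mem' := by
    intro z z' hz hz' M hM
    classical
    rw [map_add] at hM
    rcases Finset.mem_union.mp (support_add hM) with h | h
    · exact hz M h
    · exact hz' M h
  smul_mem' := by
    intro c z hz M hM
    rw [smul_eq_mul, truncQ_mul] at hM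
    have := degree_le_of_mem_support_trunc_mul (a := 0) (b := m) (fun _ _ => Nat.zero_le _) hz hM
    simpa using this

variable {K s q}

/-- Membership in the degree ideal. [folklore] -/
theorem mem_degIdeal_iff {m : ℕ} {z : BoxQuot (Fin s) K q} :
    z ∈ degIdeal K s q m ↔ ∀ M ∈ (truncQ (Fin s) K q z).support, m ≤ M.degree := Iff.rfl

/-- `degIdeal a * degIdeal b ≤ degIdeal (a + b)`. [folklore] -/
theorem degIdeal_mul_le (a b : ℕ) : degIdeal K s q a * degIdeal K s q b ≤ degIdeal K s q (a + b) := by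
  rw [Ideal.mul_le]
  intro z hz z' hz' M hM
  rw [truncQ_mul] at hM
  exact degree_le_of_mem_support_trunc_mul hz hz' hM

/-- `(degIdeal 1)^m ≤ degIdeal m`. [folklore] -/
theorem degIdeal_one_pow_le : ∀ m : ℕ, degIdeal K s q 1 ^ m ≤ degIdeal K s q m
  | 0 => by intro z _ M _; exact Nat.zero_le _
  | m + 1 =>
    calc degIdeal K s q 1 ^ (m + 1) = degIdeal K s q 1 ^ m * degIdeal K s q 1 := Submodule.pow_succ _
      _ ≤ degIdeal K s q m * degIdeal K s q 1 := Ideal.mul_mono_left (degIdeal_one_pow_le m)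
      _ ≤ degIdeal K s q (m + 1) := degIdeal_mul_le m 1

/-- The augmentation ideal lies in `degIdeal 1` (no constant term). [folklore] -/
theorem ker_augment_le_degIdeal_one (hq : 1 ≤ q) :
    RingHom.ker (augment s K q hq).toRingHom ≤ degIdeal K s q 1 := by
  intro z hz M hM
  rw [RingHom.mem_ker, AlgHom.toRingHom_eq_coe, RingHom.coe_coe, augment_eq_coeff_zero hq] at hz
  by_contra h
  have hM0 : M = 0 := by
    have : M.degree = 0 := by omega
    exact (Finsupp.degree_eq_zero_iff M).mp this
  rw [hM0, mem_support_iff] at hM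
  exact hM hz

end DegIdeal

/-! ## The tower: `J^q ↦` degrees `≥ q`, `I_S ↦` split monomials -/

section Tower

variable {L K : Type*} [Field L] [Field K] [Algebra L K] {s p e : ℕ} [hp : Fact p.Prime] [CharP K p]
  {x : Fin s → L} {a : Fin s → K}

/-- `Ω ω` is the box representative of `Ω̃ ω`. [folklore] -/
theorem IsRootTower.Omega_eq (h : IsRootTower L K (p ^ e) x a) (ω : K ⊗[L] K) :
    h.Omega ω = truncQ (Fin s) K (p ^ e) (h.omegaTilde ω) := rfl

/-- `Ω̃` maps the diagonal ideal `J` into the augmentation ideal (`μ = ev₀ ∘ Ω`).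
[cite: Mizutani1973HironakaGroupSchemes, Remark 2.10 (in-house proof §1.2: J = ker μ)] -/
theorem IsRootTower.map_omegaTilde_ideal_le (h : IsRootTower L K (p ^ e) x a) :
    (KaehlerDifferential.ideal L K).map h.omegaTilde ≤
      RingHom.ker (augment s K (p ^ e) (Nat.one_le_pow _ _ hp.out.pos)).toRingHom := by
  rw [Ideal.map_le_iff_le_comap]
  intro ω hω
  rw [Ideal.mem_comap, RingHom.mem_ker, AlgHom.toRingHom_eq_coe, RingHom.coe_coe, augment_eq_coeff_zero,
    ← h.Omega_eq, h.Omega_coeff_zero]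
  rw [KaehlerDifferential.ideal, RingHom.mem_ker] at hω
  exact hω

/-- **`ω ∈ J^m ⇒ Ω̃ ω ∈ degIdeal m`**: the coordinates of an element of `J^m` only involve monomials of degree
`≥ m`. [cite: Oda1983HironakaGroupSchemeII, §1 (p. 1166: {(δa)^λ : |λ| ≥ r} is a basis of Δ^{(r)})] -/
theorem IsRootTower.omegaTilde_mem_degIdeal (h : IsRootTower L K (p ^ e) x a) {m : ℕ} {ω : K ⊗[L] K}
    (hω : ω ∈ KaehlerDifferential.ideal L K ^ m) : h.omegaTilde ω ∈ degIdeal K s (p ^ e) m := by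
  have h1 : h.omegaTilde ω ∈ (KaehlerDifferential.ideal L K ^ m).map h.omegaTilde := Ideal.mem_map_of_mem _ hω
  rw [Ideal.map_pow] at h1
  have h2 := Ideal.pow_right_mono
    (le_trans h.map_omegaTilde_ideal_le (ker_augment_le_degIdeal_one (Nat.one_le_pow _ _ hp.out.pos))) m h1
  exact degIdeal_one_pow_le m h2

/-- **`ω ∈ J^q ⇒` every monomial of `Ω ω` has degree `≥ q`** (the hypothesis `hdeg` of `theoremF_rootTower`).
[cite: Mizutani1973HironakaGroupSchemes, Remark 2.10 (in-house proof §1.2, §2)] -/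
theorem IsRootTower.degree_le_of_mem_pow (h : IsRootTower L K (p ^ e) x a) {ω : K ⊗[L] K}
    (hω : ω ∈ KaehlerDifferential.ideal L K ^ p ^ e) : ∀ M ∈ (h.Omega ω).support, p ^ e ≤ M.degree := by
  rw [h.Omega_eq]
  exact mem_degIdeal_iff.mp (h.omegaTilde_mem_degIdeal hω)

/-! ### The Frobenius power `J^{[p]}` and the ideal `(u_i^p)` -/

variable (L) in
/-- The Frobenius power `J^{[p]} = ⟨1 ⊗ y^p − y^p ⊗ 1⟩` of the diagonal ideal of `K ⊗_L K`; `I_S = (J^{[p]})^{p^{e−1}}`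
(MIZUTANI-PROOF-g59 §1.2). [cite: Mizutani1973HironakaGroupSchemes, Remark 2.10 (in-house proof §1.2: I_S = (J^{[p]})^{q/p})] -/
def frobPowerIdeal (p : ℕ) : Ideal (K ⊗[L] K) :=
  Ideal.span (Set.range fun y : K => (1 : K) ⊗ₜ[L] (y ^ p) - (y ^ p) ⊗ₜ[L] (1 : K))

/-- `Ω̃ (1 ⊗ y) = tau y` and `Ω̃ (y ⊗ 1) = [C y]`. [folklore] -/
theorem IsRootTower.omegaTilde_one_tmul (h : IsRootTower L K (p ^ e) x a) (y : K) :
    h.omegaTilde ((1 : K) ⊗ₜ[L] y) = h.tau y ∧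
      h.omegaTilde (y ⊗ₜ[L] (1 : K)) = Ideal.Quotient.mk _ (C y) := by
  constructor
  · rw [h.omegaTilde_tmul, C_1, map_one, one_mul]
  · rw [h.omegaTilde_tmul, map_one, mul_one]

/-- **`[u_i^p] ∈ Ω̃(J^{[p]})`**: `Ω̃(1 ⊗ a_i^p − a_i^p ⊗ 1) = (a_i + u_i)^p − a_i^p = u_i^p`.
[cite: Mizutani1973HironakaGroupSchemes, Remark 2.10 (in-house proof §1.2: t_i^p generate J^{[p]})] -/
theorem IsRootTower.mk_X_pow_mem (h : IsRootTower L K (p ^ e) x a) (i : Fin s) :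
    Ideal.Quotient.mk (boxIdeal (Fin s) K (p ^ e)) (X i ^ p) ∈ (frobPowerIdeal L p).map h.omegaTilde := by
  have hgen : (1 : K) ⊗ₜ[L] (a i ^ p) - (a i ^ p) ⊗ₜ[L] (1 : K) ∈ frobPowerIdeal L (K := K) p :=
    Ideal.subset_span ⟨a i, rfl⟩
  have himg := Ideal.mem_map_of_mem h.omegaTilde hgen
  rw [map_sub, (h.omegaTilde_one_tmul (a i ^ p)).1, (h.omegaTilde_one_tmul (a i ^ p)).2, map_pow, h.tau_gen,
    ← map_pow, ← map_sub, C_pow, add_pow_char, add_sub_cancel_left] at himg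
  exact himg

/-- A product `∏_i g_i^{n_i}` with all `g_i ∈ I` lies in `I^{Σ n_i}`. [folklore] -/
theorem prod_pow_mem_pow {R : Type*} [CommSemiring R] (I : Ideal R) {ι : Type*} (t : Finset ι) (g : ι → R)
    (n : ι → ℕ) (hg : ∀ i ∈ t, g i ∈ I) : (∏ i ∈ t, g i ^ n i) ∈ I ^ (∑ i ∈ t, n i) := by
  classical
  induction t using Finset.induction_on with
  | empty => simp
  | insert j t hj ih =>
    rw [Finset.prod_insert hj, Finset.sum_insert hj, pow_add]
    exact Ideal.mul_mem_mul (Ideal.pow_mem_pow (hg j (Finset.mem_insert_self j t)) _)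
      (ih fun i hi => hg i (Finset.mem_insert_of_mem hi))

omit [CharP K p] in
/-- **A polynomial all of whose monomials have `floor ≥ m` lies in `(X_i^p : i)^m`.**
[cite: Mizutani1973HironakaGroupSchemes, Remark 2.10 (in-house proof §1.2: I_S = ⊕_{floor(M) ≥ p^{e−1}} k t^M)] -/
theorem mem_span_X_pow_pow_of_floorSum {m : ℕ} {f : MvPolynomial (Fin s) K}
    (hf : ∀ M ∈ f.support, m ≤ floorSum p M) :
    f ∈ Ideal.span (Set.range fun i : Fin s => (X i : MvPolynomial (Fin s) K) ^ p) ^ m := by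
  classical
  set I := Ideal.span (Set.range fun i : Fin s => (X i : MvPolynomial (Fin s) K) ^ p) with hI
  rw [f.as_sum]
  refine Submodule.sum_mem _ fun M hM => ?_
  have hp0 : 0 < p := hp.out.pos
  -- `X^M = C(coeff) * ∏ X_i^{M_i % p} * ∏ (X_i^p)^{M_i / p}`
  have hsplit : monomial M (coeff M f) =
      (C (coeff M f) * ∏ i, (X i : MvPolynomial (Fin s) K) ^ (M i % p)) * ∏ i, ((X i) ^ p) ^ (M i / p) := by
    rw [monomial_eq, Finsupp.prod_fintype _ _ (fun i => by simp), mul_assoc, ← Finset.prod_mul_distrib]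
    congr 1
    refine Finset.prod_congr rfl fun i _ => ?_
    rw [← pow_mul, ← pow_add, Nat.mod_add_div]
  rw [hsplit]
  refine Ideal.mul_mem_left _ _ ?_
  have hmem : (∏ i, ((X i : MvPolynomial (Fin s) K) ^ p) ^ (M i / p)) ∈ I ^ (∑ i, M i / p) :=
    prod_pow_mem_pow I Finset.univ _ _ fun i _ => Ideal.subset_span ⟨i, rfl⟩
  have hfloor : m ≤ ∑ i, M i / p := by rw [← floorSum_eq_sum]; exact hf M hM
  exact Ideal.pow_le_pow_right hfloor hmem

/-- If every monomial of `Ω ω` has `floor ≥ p^{e−1}`, then `Ω̃ ω ∈ Ω̃(I_S)`. [cite: Mizutani1973HironakaGroupSchemes, Remark 2.10 (in-house proof §1.2)] -/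
theorem IsRootTower.omegaTilde_mem_map_of_floorSum (h : IsRootTower L K (p ^ e) x a) {ω : K ⊗[L] K}
    (hω : ∀ M ∈ (h.Omega ω).support, p ^ (e - 1) ≤ floorSum p M) :
    h.omegaTilde ω ∈ (frobPowerIdeal L p ^ p ^ (e - 1)).map h.omegaTilde := by
  have hf := mem_span_X_pow_pow_of_floorSum (K := K) hω
  have himg := Ideal.mem_map_of_mem (Ideal.Quotient.mk (boxIdeal (Fin s) K (p ^ e))) hf
  rw [h.Omega_eq, mk_truncQ, Ideal.map_pow, Ideal.map_span] at himg
  rw [Ideal.map_pow]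
  refine Ideal.pow_right_mono ?_ _ himg
  rw [Ideal.span_le]
  rintro _ ⟨_, ⟨i, rfl⟩, rfl⟩
  exact h.mk_X_pow_mem i

/-! ### `Ω̃` is bijective when `[K : L] = q^s` -/

/-- `Ω̃` as a `K`-linear map (left structure). [folklore] -/
noncomputable def IsRootTower.omegaLin (h : IsRootTower L K (p ^ e) x a) :
    K ⊗[L] K →ₗ[K] BoxQuot (Fin s) K (p ^ e) where
  toFun := h.omegaTilde
  map_add' ω ω' := map_add _ ω ω'
  map_smul' c ω := by
    rw [h.omegaTilde_smul, RingHom.id_apply]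
    exact (Algebra.smul_def c _).symm

/-- `Ω̃` is surjective: its range contains `[C y]` and `[u_i] = tau a_i − [C a_i]`. [folklore] -/
theorem IsRootTower.omegaTilde_surjective (h : IsRootTower L K (p ^ e) x a) : Function.Surjective h.omegaTilde := by
  intro z
  obtain ⟨f, rfl⟩ := Ideal.Quotient.mk_surjective z
  induction f using MvPolynomial.induction_on with
  | C c => exact ⟨c ⊗ₜ 1, (h.omegaTilde_one_tmul c).2⟩
  | add f g hf hg =>
    obtain ⟨ω, hω⟩ := hf
    obtain ⟨ω', hω'⟩ := hg
    exact ⟨ω + ω', by rw [map_add, hω, hω', map_add]⟩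
  | mul_X f i hf =>
    obtain ⟨ω, hω⟩ := hf
    refine ⟨ω * ((1 : K) ⊗ₜ[L] a i - a i ⊗ₜ[L] 1), ?_⟩
    rw [map_mul, hω, map_sub, (h.omegaTilde_one_tmul (a i)).1, (h.omegaTilde_one_tmul (a i)).2, h.tau_gen,
      ← map_sub, add_sub_cancel_left, map_mul]

/-- The set of box exponents. [folklore] -/
def boxSet (s q : ℕ) : Set (Fin s →₀ ℕ) := {M | InBox q M}

/-- The box exponents as a finite type. [folklore] -/
noncomputable instance boxSet_fintype (s q : ℕ) : Fintype (boxSet s q) :=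
  Fintype.ofEquiv (Box (Fin s) q)
    { toFun := fun W => ⟨W.toF, Box.inBox_toF W⟩
      invFun := fun M => Box.ofF M.1 M.2
      left_inv := fun W => by
        funext i; apply Fin.ext; simp [Box.ofF]
      right_inv := fun M => Subtype.ext (Box.toF_ofF M.1 M.2) }

/-- There are `q^s` box exponents. [folklore] -/
theorem card_boxSet (s q : ℕ) : Fintype.card (boxSet s q) = q ^ s := by
  rw [Fintype.ofEquiv_card, Fintype.card_fun, Fintype.card_fin, Fintype.card_fin]

/-- `dim_K K[u]/(u^q) = q^s` (the box monomials form a basis). [cite: Oda1983HironakaGroupSchemeII, §1 (p. 1166)] -/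
theorem finrank_boxQuot (s q : ℕ) : Module.finrank K (BoxQuot (Fin s) K q) = q ^ s := by
  classical
  set b : boxSet s q → MvPolynomial (Fin s) K :=
    (⇑(MvPolynomial.basisMonomials (Fin s) K)) ∘ (Subtype.val : boxSet s q → Fin s →₀ ℕ) with hb
  have hbM : ∀ M : boxSet s q, b M = monomial M.1 1 := fun M => by
    rw [hb, Function.comp_apply, MvPolynomial.coe_basisMonomials]
  have hbi : LinearIndependent K b :=
    (MvPolynomial.basisMonomials (Fin s) K).linearIndependent.comp _ Subtype.val_injective
  -- `truncQ` is a `K`-linear injection onto the span of the box monomials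
  have hrange : LinearMap.range (truncQ (Fin s) K q) = Submodule.span K (Set.range b) := by
    apply le_antisymm
    · rintro _ ⟨z, rfl⟩
      rw [(truncQ (Fin s) K q z).as_sum]
      refine Submodule.sum_mem _ fun M hM => ?_
      have hmono : monomial M (coeff M (truncQ (Fin s) K q z)) =
          coeff M (truncQ (Fin s) K q z) • b ⟨M, inBox_of_mem_support_truncQ z hM⟩ := by
        rw [hbM, smul_monomial, smul_eq_mul, mul_one]
      rw [hmono]
      exact Submodule.smul_mem _ _ (Submodule.subset_span ⟨⟨M, inBox_of_mem_support_truncQ z hM⟩, rfl⟩)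
    · rw [Submodule.span_le]
      rintro _ ⟨M, rfl⟩
      refine ⟨Ideal.Quotient.mk _ (monomial M.1 1), ?_⟩
      rw [truncQ_mk, trunc_monomial, if_pos (show InBox q (M : Fin s →₀ ℕ) from M.2), hbM]
  have hinj : Function.Injective (truncQ (Fin s) K q) := by
    intro z z' hzz'
    rw [← mk_truncQ z, ← mk_truncQ z', hzz']
  rw [← LinearMap.finrank_range_of_inj hinj, hrange, finrank_span_eq_card hbi, card_boxSet]

/-- `K[u]/(u^q)` is finite-dimensional. [folklore] -/
theorem finite_boxQuot (s q : ℕ) (hq : 1 ≤ q) : Module.Finite K (BoxQuot (Fin s) K q) :=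
  Module.finite_of_finrank_pos (by rw [finrank_boxQuot]; exact Nat.pow_pos hq)

/-- **`Ω̃` is bijective** when `[K : L] = q^s` (both sides have `K`-dimension `q^s` and `Ω̃` is onto).
[cite: Oda1983HironakaGroupSchemeII, §1 (p. 1166: R = k ⊗_L k ≅ k[t]/(t^q))] -/
theorem IsRootTower.omegaTilde_bijective (h : IsRootTower L K (p ^ e) x a)
    (hdim : Module.finrank L K = (p ^ e) ^ s) : Function.Bijective h.omegaTilde := by
  haveI := h.finiteDimensional
  haveI : Module.Finite K (BoxQuot (Fin s) K (p ^ e)) := finite_boxQuot s (p ^ e) (Nat.one_le_pow _ _ hp.out.pos)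
  have hsurj : Function.Surjective h.omegaLin := h.omegaTilde_surjective
  have heq : Module.finrank K (K ⊗[L] K) = Module.finrank K (BoxQuot (Fin s) K (p ^ e)) := by
    rw [Module.finrank_baseChange, hdim, finrank_boxQuot]
  have hinj : Function.Injective h.omegaLin :=
    (LinearMap.injective_iff_surjective_of_finrank_eq_finrank heq).mpr hsurj
  exact ⟨hinj, h.omegaTilde_surjective⟩

/-- **`ω ∉ I_S ⇒ Ω ω` has a GENUINE monomial** (given `ω ∈ J^q`, `[K : L] = q^s`, `e ≥ 1`).
[cite: Mizutani1973HironakaGroupSchemes, Remark 2.10 (in-house proof §1.2: genuine = J^q ∖ I_S)] -/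
theorem IsRootTower.exists_isGenuine_of_not_mem (h : IsRootTower L K (p ^ e) x a)
    (hdim : Module.finrank L K = (p ^ e) ^ s) {ω : K ⊗[L] K}
    (hJ : ω ∈ KaehlerDifferential.ideal L K ^ p ^ e) (hI : ω ∉ frobPowerIdeal L p ^ p ^ (e - 1)) :
    ∃ M ∈ (h.Omega ω).support, IsGenuine p e M := by
  by_contra hcon
  push Not at hcon
  apply hI
  have hfloor : ∀ M ∈ (h.Omega ω).support, p ^ (e - 1) ≤ floorSum p M := by
    intro M hM
    have h1 := hcon M hM
    unfold IsGenuine at h1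
    have hbox := h.Omega_box ω M hM
    have hdeg := h.degree_le_of_mem_pow hJ M hM
    by_contra hlt
    exact h1 ⟨hbox, hdeg, by omega⟩
  have hmem := h.omegaTilde_mem_map_of_floorSum hfloor
  have hcomap : ω ∈ ((frobPowerIdeal L p ^ p ^ (e - 1)).map h.omegaTilde).comap h.omegaTilde := hmem
  rw [Ideal.comap_map_of_surjective _ (h.omegaTilde_bijective hdim).2] at hcomap
  have hker : Ideal.comap h.omegaTilde ⊥ = ⊥ := by
    rw [← RingHom.ker_eq_comap_bot]
    exact (RingHom.injective_iff_ker_eq_bot _).mp (h.omegaTilde_bijective hdim).1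
  rw [hker, sup_bot_eq] at hcomap
  exact hcomap

/-- A genuine monomial forces `s ≥ 2` and `e ≥ 1`. [folklore] -/
theorem two_le_of_isGenuine {M : Fin s →₀ ℕ} (hM : IsGenuine p e M) : 2 ≤ s ∧ 1 ≤ e := by
  obtain ⟨hbox, hdeg, hfloor⟩ := hM
  have hp1 : 1 < p := hp.out.one_lt
  constructor
  · by_contra hs
    have hs' : s ≤ 1 := by omega
    -- with at most one variable, `|M| = M 0 < q`
    rcases Nat.lt_or_ge s 1 with h0 | h1
    · have : s = 0 := by omega
      subst this
      have : M.degree = 0 := by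
        rw [Finsupp.degree_eq_sum]; simp
      have hq : 1 ≤ p ^ e := Nat.one_le_pow _ _ hp.out.pos
      omega
    · have : s = 1 := by omega
      subst this
      have hd : M.degree = M 0 := by
        rw [Finsupp.degree_eq_sum, Fin.sum_univ_one]
      have := hbox 0
      omega
  · by_contra he
    have he0 : e = 0 := by omega
    subst he0
    rw [pow_zero] at hbox hdeg
    have hM0 : M = 0 := by
      ext i
      have := hbox i
      simp only [Finsupp.coe_zero, Pi.zero_apply]
      omega
    rw [hM0, map_zero] at hdeg
    omega

/-- **THEOREM F, intrinsic form**: in a tower `K = L(x^{1/q})` with `[K : L] = q^s` over an infinite field `L`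
of characteristic `p`, every `ω ∈ K ⊗_L K` with `ω ∈ J^q` and `ω ∉ I_S = (J^{[p]})^{p^{e−1}}` has tensor rank
`≥ 2q` (MIZUTANI-PROOF-g59 §2/§9; the coordinate hypotheses of `theoremF_rootTower` derived from §1.2).
[cite: Mizutani1973HironakaGroupSchemes, Remark 2.10 (in-house proof §2, THEOREM F)] -/
theorem theoremF_of_mem_pow [Infinite L] (h : IsRootTower L K (p ^ e) x a)
    (hdim : Module.finrank L K = (p ^ e) ^ s) (ω : K ⊗[L] K)
    (hJ : ω ∈ KaehlerDifferential.ideal L K ^ p ^ e) (hI : ω ∉ frobPowerIdeal L p ^ p ^ (e - 1)) :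
    2 * p ^ e ≤ tensorRank L ω := by
  obtain ⟨M, hM, hgen⟩ := h.exists_isGenuine_of_not_mem hdim hJ hI
  obtain ⟨hs, he⟩ := two_le_of_isGenuine hgen
  exact theoremF_rootTower h hs he ω (h.degree_le_of_mem_pow hJ) ⟨M, hM, hgen⟩

end Tower

end Summit.ResolutionOfSingularities.KangarooAtlas.Mizutani
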